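import Summits.Schanuel.Schanuel.Theorems.ZilberEacInvariantDirectionDensity
import Summits.Schanuel.Schanuel.Theorems.ZilberEacCriticalFibresDensity
import HarnessLib

/-!
# REVIEW-RUNBOOK sanity lemmas — joint satisfiability of the hypothesis telescopes of three
# Zilber-EAC density theorems (client `pub-schanuel` of the ops review-runbook generator)

Card (2)(b) («non-vacuity») of `run/shared/lean/pub/pub-schanuel/REVIEW-RUNBOOK.md`.  Three of the
cell's END THEOREMS on Exponential-Algebraic Closedness (`Theorems/ZilberEac*.lean`) quantify over
polynomial data under side conditions; this file records, as closed theorems `∃ objects, h₁ ∧ … ∧ hₙ`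
(the shape the generator's probe matches), that each telescope is met by explicit, non-degenerate data —
in two cases the cell's OWN worked example:

* `unprojectedDense_polyFibredGraph_critical_fibres`: fibre polynomials `F₀ = F₁ = X` (`F₀ ≠ 0`,
  `deg F₁ ≤ deg F₀`) and the irrational slope `r₀ = √2` — the data of the cell's example
  `sqrtTwoHalfSqOne_member_dense` up to the choice of fibres;
* `unprojectedDense_polyFibredGraph_balance`: `s = 1`, `g = X₀² − X₁²` (the Mantova–Masser model
  polynomial, `deg g = 2`), fibres `f = (X, 1)` (both `≠ 0`), and the BALANCE DIRECTION condition
  `g_top(deg f₀ + 1, deg f₁ + 1) = g(2, 1) = 3 ≠ 0`;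
* `unprojectedDense_polyFibredGraph_equivariantDirection_real`: the cell's invariant-direction example
  (`negSqDiff_data`): `s = 1`, `g = −(X₀ − X₁)²`, period direction `q = (1,1)` with `β = 0`
  (`g` is INVARIANT under translation by `(1,1)`), `ℓ₀ = (1,−1)` (`Re g_top(2πiℓ₀) = 16π² ≠ 0`, both
  entries `≠ 0`), `A = (X₀, X₁)` (`deg Aⱼ = 1 = λ qⱼ` with `λ = 1`, `A_top(2πiq) = 2πi ≠ 0`), constant
  fibres `f = (0, 0)` (the slow-fibre inequality reads `0 < 1`).

Review evidence only (`--supports`; the file closes no item); no definitions, no `sorry`, standard axioms.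
-/

noncomputable section

namespace Summit.Schanuel.Schanuel.Theorems.RunbookZilberEac

open MvPolynomial Complex
open Summit.Schanuel.Schanuel.Theorems (negSqDiff_data)

/-! ### `unprojectedDense_polyFibredGraph_critical_fibres` -/

/-- (b) **The three hypotheses of `unprojectedDense_polyFibredGraph_critical_fibres` hold together**:
`F = (X, X)` has `F 0 = X ≠ 0` and `deg F₁ ≤ deg F₀`, and `r₀ = √2` is irrational. [folklore] -/
theorem critical_fibres_hypotheses :
    ∃ (F : Fin 2 → Polynomial ℂ) (r₀ : ℝ),
      F 0 ≠ 0 ∧ (F 1).natDegree ≤ (F 0).natDegree ∧ Irrational r₀ :=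
  ⟨fun _ => Polynomial.X, Real.sqrt 2, Polynomial.X_ne_zero, le_rfl, irrational_sqrt_two⟩

/-! ### `unprojectedDense_polyFibredGraph_balance` -/

/-- `X₀² − X₁²` is homogeneous of degree `2`, non-zero, of total degree exactly `2`, with
`(X₀² − X₁²)(x) = x₀² − x₁²`. [folklore] -/
theorem sqDiff_facts :
    (X 0 ^ 2 - X 1 ^ 2 : MvPolynomial (Fin 2) ℂ).IsHomogeneous 2 ∧
      (X 0 ^ 2 - X 1 ^ 2 : MvPolynomial (Fin 2) ℂ).totalDegree = 2 ∧
        ∀ x : Fin 2 → ℂ, eval x (X 0 ^ 2 - X 1 ^ 2 : MvPolynomial (Fin 2) ℂ) = x 0 ^ 2 - x 1 ^ 2 := by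
  have hhom : (X 0 ^ 2 - X 1 ^ 2 : MvPolynomial (Fin 2) ℂ).IsHomogeneous 2 :=
    (isHomogeneous_X_pow 0 2).sub (isHomogeneous_X_pow 1 2)
  have heval : ∀ x : Fin 2 → ℂ, eval x (X 0 ^ 2 - X 1 ^ 2 : MvPolynomial (Fin 2) ℂ) =
      x 0 ^ 2 - x 1 ^ 2 := fun x => by simp [map_sub, map_pow, eval_X]
  have h0 : (X 0 ^ 2 - X 1 ^ 2 : MvPolynomial (Fin 2) ℂ) ≠ 0 := by
    intro h
    have := heval ![1, 0]
    rw [h, map_zero] at this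
    norm_num at this
  exact ⟨hhom, hhom.totalDegree h0, heval⟩

/-- (b) **The three hypotheses of `unprojectedDense_polyFibredGraph_balance` hold together,
non-degenerately**: `s = 1`, `g = X₀² − X₁²` (`2 ≤ deg g`), fibres `f = (X, 1)` (both non-zero), and the
top homogeneous part of `g` does not vanish at the balance direction `(deg f₀ + 1, deg f₁ + 1) = (2, 1)`:
`g(2,1) = 3 ≠ 0`. [folklore] -/
theorem balance_hypotheses :
    ∃ (g : MvPolynomial (Fin 2) ℂ) (f : Fin 2 → Polynomial ℂ),
      2 ≤ g.totalDegree ∧ (∀ j : Fin 2, f j ≠ 0) ∧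
        eval (fun j => (((f j).natDegree + 1 : ℕ) : ℂ)) (homogeneousComponent g.totalDegree g) ≠ 0 := by
  obtain ⟨hhom, hdeg, heval⟩ := sqDiff_facts
  refine ⟨X 0 ^ 2 - X 1 ^ 2, ![Polynomial.X, Polynomial.C 1], hdeg.symm.le, fun j => ?_, ?_⟩
  · fin_cases j
    · exact Polynomial.X_ne_zero
    · simp
  · rw [hdeg, homogeneousComponent_eq_self hhom, heval]
    simp only [Matrix.cons_val_zero, Matrix.cons_val_one, Polynomial.natDegree_X, Polynomial.natDegree_C]
    norm_num

/-! ### `unprojectedDense_polyFibredGraph_equivariantDirection_real` -/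

/-- `Xⱼ` has total degree `1` and is its own top homogeneous component, `Xⱼ(x) = xⱼ`. [folklore] -/
theorem X_facts (j : Fin 2) :
    (X j : MvPolynomial (Fin 2) ℂ).totalDegree = 1 ∧
      homogeneousComponent 1 (X j : MvPolynomial (Fin 2) ℂ) = X j :=
  ⟨totalDegree_X j, homogeneousComponent_eq_self (isHomogeneous_X ℂ j)⟩

/-- (b) **The seven object hypotheses of `unprojectedDense_polyFibredGraph_equivariantDirection_real`
hold together**, at the cell's invariant-direction example (`negSqDiff_data`): `s = 1`,
`g = −(X₀ − X₁)²` (`0 < deg g = 2`), `q = (1,1)`, `β = 0` (translation by `z·(1,1)` leaves `g` fixed: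
`g(x + z q) = g(x) + 0·z`), `ℓ₀ = (1,−1)` (`Re g_top(2πiℓ₀) ≠ 0`, `ℓ₀ⱼ ≠ 0`), `A = (X₀, X₁)`
(`Aⱼ,top(2πiq) = 2πi ≠ 0`), `λ = 1` (`deg Aⱼ = 1 = λ·qⱼ`), `f = (0, 0)`
(`βλ + max(βλ,0)·deg fⱼ = 0 < 1 = deg Aⱼ`). [folklore] -/
theorem equivariantDirection_real_hypotheses :
    ∃ (g : MvPolynomial (Fin 2) ℂ) (q : Fin 2 → ℤ) (β : ℝ) (ℓ₀ : Fin 2 → ℤ)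
      (A : Fin 2 → MvPolynomial (Fin 2) ℂ) (lam : ℝ) (f : Fin 2 → Polynomial ℂ),
      0 < g.totalDegree ∧
      (∀ (x : Fin 2 → ℂ) (z : ℂ), eval (x + z • fun j => (q j : ℂ)) g = eval x g + (β : ℂ) * z) ∧
      (eval (fun j => 2 * (Real.pi : ℂ) * I * (ℓ₀ j : ℂ)) (homogeneousComponent g.totalDegree g)).re ≠ 0 ∧
      (∀ j, ℓ₀ j ≠ 0) ∧
      (∀ j, eval (fun i => 2 * (Real.pi : ℂ) * I * (q i : ℂ))
        (homogeneousComponent (A j).totalDegree (A j)) ≠ 0) ∧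
      (∀ j, ((A j).totalDegree : ℝ) = lam * (q j : ℝ)) ∧
      (∀ j, β * lam + max (β * lam) 0 * ((f j).natDegree : ℝ) < ((A j).totalDegree : ℝ)) := by
  obtain ⟨hdeg, hinv, hℓ₀, -, -⟩ := negSqDiff_data
  refine ⟨-(X 0 - X 1) ^ 2, ![1, 1], 0, ![1, -1], fun j => X j, 1, fun _ => 0, by rw [hdeg]; norm_num,
    fun x z => ?_, hℓ₀, fun j => by fin_cases j <;> decide, fun j => ?_, fun j => ?_, fun j => ?_⟩
  · rw [hinv x z]; push_cast; ring
  · rw [(X_facts j).1, (X_facts j).2, eval_X]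
    fin_cases j <;>
      simp [Matrix.cons_val_zero, Matrix.cons_val_one, Real.pi_ne_zero, I_ne_zero]
  · rw [(X_facts j).1]; fin_cases j <;> simp
  · rw [(X_facts j).1]; simp

end Summit.Schanuel.Schanuel.Theorems.RunbookZilberEac

end
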